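import Literature.NumberTheory.LFunctions.IvicNearOneDetection
import HarnessLib

/-!
# Ivić 1985, Theorem 11.3: the outer reduction (ranges, Vinogradov–Korobov clamp, Richert WLOG)

NOT RH-BEARING (D-0040; bears_on LADDER-RH §4 HELD row `DensityLadder`, stmt-19600): a density
theorem counts zeros off the line, it never empties the strip (Barrier `LindelofBacklund`).

`σ = 1` is trivial (`N(1,T) = 0`); for `1 − σ < c/(log T)^{5/7}` the Vinogradov–Korobov clamp
gives `N(σ,T) = 0` (`IvicNearOneDetect.zetaZeroCountRe_eq_zero_of_clamp`, in place of Ivić's use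
of the classical zero-free region (1.55), p. 280); otherwise one may assume
`M ≤ M_R := A T^{B(1−σ)^{3/2}} log T` because `M_R` is itself an admissible majorant of
`|ζ(5σ−4+it)|` on `1 ≤ t ≤ 3T` (Richert, Ivić (11.53)) and the right-hand side of (11.32) is
monotone in `M`. `theorem11_3_of_core` reduces the typed fact `Ivic1985_theorem11_3` to the CORE
statement on that regime.

## References
* [Ivic1985] A. Ivić, *The Riemann zeta-function*, Wiley 1985, §11.4, Theorem 11.3 (11.32) and
  its proof, (11.53), pp. 277–281.
-/

noncomputable section

open Complex Filter Topology Set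
open scoped Real

namespace Literature.NumberTheory.LFunctions

namespace IvicApex

/-- `ζ` is bounded on `1/2 ≤ Re s ≤ 1`, `1 ≤ Im s ≤ 3` (continuity away from the pole), bound
`K₀ ≥ 1`. [folklore] -/
private theorem exists_norm_zeta_le_small_height :
    ∃ K : ℝ, 1 ≤ K ∧ ∀ α t : ℝ, 1 / 2 ≤ α → α ≤ 1 → 1 ≤ t → t ≤ 3 →
      ‖riemannZeta (α + t * I)‖ ≤ K := by
  have hc : IsCompact (Set.Icc (1 / 2 : ℝ) 1 ×ℂ Set.Icc (1 : ℝ) 3) :=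
    isCompact_Icc.reProdIm isCompact_Icc
  have hcont : ContinuousOn riemannZeta (Set.Icc (1 / 2 : ℝ) 1 ×ℂ Set.Icc (1 : ℝ) 3) := by
    intro s hs
    refine (differentiableAt_riemannZeta ?_).continuousAt.continuousWithinAt
    rintro rfl
    rw [Complex.mem_reProdIm] at hs
    have := hs.2.1
    norm_num at this
  obtain ⟨K, hK⟩ := hc.exists_bound_of_continuousOn hcont
  refine ⟨max K 1, le_max_right _ _, fun α t h1 h2 h3 h4 ↦ (hK _ ?_).trans (le_max_left _ _)⟩
  have hre : ((α : ℂ) + t * I).re = α := by simp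
  have him : ((α : ℂ) + t * I).im = t := by simp
  rw [Complex.mem_reProdIm, hre, him]
  exact ⟨⟨h1, h2⟩, ⟨h3, h4⟩⟩

/-- `(5η)^{3/2} ≤ 12 η^{3/2}` for `η ≥ 0` (`5^{3/2} ≤ 12`). [folklore] -/
private theorem five_mul_rpow_three_halves_le {η : ℝ} (hη : 0 ≤ η) :
    (5 * η) ^ (3 / 2 : ℝ) ≤ 12 * η ^ (3 / 2 : ℝ) := by
  rw [Real.mul_rpow (by norm_num) hη]
  refine mul_le_mul_of_nonneg_right ?_ (Real.rpow_nonneg hη _)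
  have h : ((5 : ℝ) ^ (3 / 2 : ℝ)) ^ (2 : ℕ) ≤ (12 : ℝ) ^ (2 : ℕ) := by
    rw [← Real.rpow_natCast, ← Real.rpow_mul (by norm_num)]
    norm_num
  exact (pow_le_pow_iff_left₀ (Real.rpow_nonneg (by norm_num) _) (by norm_num) two_ne_zero).1 h

/-- **An admissible Richert-type majorant on the line `α = 5σ − 4`** (Ivić (11.53) with the tree's
inexplicit constants): there are `A ≥ 1`, `B ≥ 0` such that for `T ≥ 3`, `9/10 ≤ σ ≤ 1` and
`1 ≤ t ≤ 3T`, `|ζ(5σ − 4 + it)| ≤ A · T^{B(1−σ)^{3/2}} · log T` (`exists_richertTypeBound_one` on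
`3 ≤ t ≤ 3T`, compactness on `1 ≤ t ≤ 3`).
[cite: Ivic1985, §11.4, proof of Theorem 11.3, (11.53), p. 281] -/
theorem exists_majorant_line_five :
    ∃ A B : ℝ, 1 ≤ A ∧ 0 ≤ B ∧ ∀ T : ℝ, 3 ≤ T → ∀ σ : ℝ, 9 / 10 ≤ σ → σ ≤ 1 →
      ∀ t : ℝ, 1 ≤ t → t ≤ 3 * T →
        ‖riemannZeta (((5 * σ - 4 : ℝ) : ℂ) + t * I)‖ ≤
          A * T ^ (B * (1 - σ) ^ (3 / 2 : ℝ)) * Real.log T := by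
  obtain ⟨A₀, B₀, hA₀, hB₀, hR⟩ := exists_richertTypeBound_one
  obtain ⟨K₀, hK₀1, hK₀⟩ := exists_norm_zeta_le_small_height
  refine ⟨2 * A₀ + K₀, 24 * B₀, by linarith, by positivity, fun T hT σ hσ hσ1 t ht1 ht2 ↦ ?_⟩
  have hT0 : 0 < T := by linarith
  have hT1 : 1 ≤ T := by linarith
  set η : ℝ := 1 - σ with hη
  have hη0 : 0 ≤ η := by rw [hη]; linarith
  have hα : 1 / 2 ≤ 5 * σ - 4 := by linarith
  have hα1 : 5 * σ - 4 ≤ 1 := by linarith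
  have h1α : 1 - (5 * σ - 4) = 5 * η := by rw [hη]; ring
  have hL1 : 1 ≤ Real.log T := by
    have h3 : Real.exp 1 ≤ 3 := by have := Real.exp_one_lt_d9; linarith
    exact (Real.le_log_iff_exp_le hT0).2 (h3.trans hT)
  have hE1 : 1 ≤ T ^ (24 * B₀ * η ^ (3 / 2 : ℝ)) := Real.one_le_rpow hT1 (by positivity)
  have hmain : A₀ * T ^ (24 * B₀ * η ^ (3 / 2 : ℝ)) * (2 * Real.log T) + K₀ ≤
      (2 * A₀ + K₀) * T ^ (24 * B₀ * η ^ (3 / 2 : ℝ)) * Real.log T := by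
    have h1 : K₀ ≤ K₀ * T ^ (24 * B₀ * η ^ (3 / 2 : ℝ)) * Real.log T := by
      have := mul_le_mul hE1 hL1 zero_le_one (by positivity)
      nlinarith
    nlinarith
  have hexpσ : 24 * B₀ * η ^ (3 / 2 : ℝ) = 24 * B₀ * (1 - σ) ^ (3 / 2 : ℝ) := by rw [hη]
  rw [← hexpσ]
  refine le_trans ?_ hmain
  rcases lt_or_ge t 3 with h3 | h3
  · have h := hK₀ (5 * σ - 4) t hα hα1 ht1 h3.le
    push_cast at h ⊢
    have hpos : 0 ≤ A₀ * T ^ (24 * B₀ * η ^ (3 / 2 : ℝ)) * (2 * Real.log T) := by positivity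
    linarith
  · have ht0 : 0 < t := by linarith
    have htabs : |t| = t := abs_of_pos ht0
    have h := hR (5 * σ - 4) t (by rw [htabs]; exact h3) hα hα1
    rw [Real.rpow_one, h1α, htabs] at h
    push_cast at h ⊢
    have hexp0 : 0 ≤ B₀ * (5 * η) ^ (3 / 2 : ℝ) := by positivity
    have h1 : t ^ (B₀ * (5 * η) ^ (3 / 2 : ℝ)) ≤ T ^ (24 * B₀ * η ^ (3 / 2 : ℝ)) := by
      calc t ^ (B₀ * (5 * η) ^ (3 / 2 : ℝ)) ≤ (3 * T) ^ (B₀ * (5 * η) ^ (3 / 2 : ℝ)) :=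
            Real.rpow_le_rpow ht0.le ht2 hexp0
        _ ≤ (T ^ 2) ^ (B₀ * (5 * η) ^ (3 / 2 : ℝ)) :=
            Real.rpow_le_rpow (by linarith) (by nlinarith) hexp0
        _ = T ^ (2 * (B₀ * (5 * η) ^ (3 / 2 : ℝ))) := by
            rw [show (T ^ 2 : ℝ) = T ^ (2 : ℝ) by norm_cast, ← Real.rpow_mul hT0.le]
        _ ≤ T ^ (24 * B₀ * η ^ (3 / 2 : ℝ)) := by
            refine Real.rpow_le_rpow_of_exponent_le hT1 ?_
            have := five_mul_rpow_three_halves_le hη0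
            nlinarith
    have h2 : Real.log t ≤ 2 * Real.log T := by
      calc Real.log t ≤ Real.log (3 * T) := Real.log_le_log ht0 ht2
        _ ≤ Real.log (T ^ 2) := Real.log_le_log (by linarith) (by nlinarith)
        _ = 2 * Real.log T := by rw [Real.log_pow]; norm_num
    have hlog0 : 0 ≤ Real.log t := Real.log_nonneg (by linarith)
    calc ‖riemannZeta (5 * (σ : ℂ) - 4 + (t : ℂ) * I)‖
        ≤ A₀ * t ^ (B₀ * (5 * η) ^ (3 / 2 : ℝ)) * Real.log t := h
      _ ≤ A₀ * T ^ (24 * B₀ * η ^ (3 / 2 : ℝ)) * (2 * Real.log T) := by gcongr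
      _ ≤ A₀ * T ^ (24 * B₀ * η ^ (3 / 2 : ℝ)) * (2 * Real.log T) + K₀ := by linarith

/-- **The outer shell of Theorem 11.3** (census §R): the typed fact `Ivic1985_theorem11_3` follows
from the CORE bound on the regime `9/10 ≤ σ < 1`, `c/(log T)^{5/7} ≤ 1 − σ` (outside it
`N(σ,T) = 0` by the Vinogradov–Korobov clamp `IvicNearOneDetect.zetaZeroCountRe_eq_zero_of_clamp`,
or `σ = 1`), and for majorants `M ≤ A T^{B(1−σ)^{3/2}} log T` (WLOG by `exists_majorant_line_five`
and the monotonicity of `C M^{7/6} (log T)^{169/12}` in `M`). The core is quantified over the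
clamp constant `c > 0` and the Richert constants `A ≥ 1`, `B ≥ 0`, whatever they are.
[cite: Ivic1985, §11.4 Theorem 11.3 (11.32) and its proof, pp. 277–281] -/
theorem theorem11_3_of_core
    (hcore : ∀ c A B : ℝ, 0 < c → 1 ≤ A → 0 ≤ B →
      ∃ C₁ : ℝ, 0 < C₁ ∧ ∃ T₂ : ℝ, ∀ T : ℝ, T₂ ≤ T → ∀ σ : ℝ, 9 / 10 ≤ σ → σ < 1 →
        c / Real.log T ^ (5 / 7 : ℝ) ≤ 1 - σ → ∀ M : ℝ,
        (∀ t : ℝ, 1 ≤ t → t ≤ 3 * T → ‖riemannZeta (((5 * σ - 4 : ℝ) : ℂ) + t * I)‖ ≤ M) →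
        M ≤ A * T ^ (B * (1 - σ) ^ (3 / 2 : ℝ)) * Real.log T →
        (zetaZeroCountRe σ T : ℝ) ≤ C₁ * M ^ (7 / 6 : ℝ) * Real.log T ^ (169 / 12 : ℝ)) :
    Ivic1985_theorem11_3 := by
  obtain ⟨c, hc, T₁, hT₁3, hclamp⟩ := IvicNearOneDetect.zetaZeroCountRe_eq_zero_of_clamp
  obtain ⟨A, B, hA, hB, hRich⟩ := exists_majorant_line_five
  obtain ⟨C₁, hC₁, T₂, hcore'⟩ := hcore c A B hc hA hB
  refine ⟨C₁, hC₁, max T₁ T₂, fun T hT σ hσ hσ1 M hM ↦ ?_⟩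
  have hTT₁ : T₁ ≤ T := le_trans (le_max_left _ _) hT
  have hTT₂ : T₂ ≤ T := le_trans (le_max_right _ _) hT
  have hT3 : 3 ≤ T := le_trans hT₁3 hTT₁
  have hT0 : 0 < T := by linarith
  have hL0 : 0 ≤ Real.log T := Real.log_nonneg (by linarith)
  -- `M ≥ 0` from the hypothesis at `t = 1`
  have hM0 : 0 ≤ M := le_trans (norm_nonneg _) (hM 1 le_rfl (by linarith))
  have hRHS0 : 0 ≤ C₁ * M ^ (7 / 6 : ℝ) * Real.log T ^ (169 / 12 : ℝ) := by positivity
  -- `σ = 1`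
  rcases eq_or_lt_of_le hσ1 with h1 | hσlt
  · rw [h1, zetaZeroCountRe_eq_zero_of_one_le le_rfl]
    simpa using hRHS0
  -- the clamp
  rcases lt_or_ge (1 - σ) (c / Real.log T ^ (5 / 7 : ℝ)) with hsmall | hbig
  · have h0 : zetaZeroCountRe σ T = 0 := (hclamp T hTT₁).2 σ (by linarith)
    rw [h0]; simpa using hRHS0
  -- WLOG `M ≤ M_R`
  set MR : ℝ := A * T ^ (B * (1 - σ) ^ (3 / 2 : ℝ)) * Real.log T with hMR
  set M' : ℝ := min M MR with hM'
  have hM'maj : ∀ t : ℝ, 1 ≤ t → t ≤ 3 * T →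
      ‖riemannZeta (((5 * σ - 4 : ℝ) : ℂ) + t * I)‖ ≤ M' := fun t h1 h2 ↦
    le_min (hM t h1 h2) (hRich T hT3 σ hσ hσ1 t h1 h2)
  have hM'R : M' ≤ MR := min_le_right _ _
  have hM'M : M' ≤ M := min_le_left _ _
  have hM'0 : 0 ≤ M' := le_trans (norm_nonneg _) (hM'maj 1 le_rfl (by linarith))
  have h := hcore' T hTT₂ σ hσ hσlt hbig M' hM'maj hM'R
  refine h.trans ?_
  have hpow : M' ^ (7 / 6 : ℝ) ≤ M ^ (7 / 6 : ℝ) := Real.rpow_le_rpow hM'0 hM'M (by norm_num)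
  have : C₁ * M' ^ (7 / 6 : ℝ) ≤ C₁ * M ^ (7 / 6 : ℝ) := mul_le_mul_of_nonneg_left hpow hC₁.le
  exact mul_le_mul_of_nonneg_right this (Real.rpow_nonneg hL0 _)

end IvicApex

end Literature.NumberTheory.LFunctions
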